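import Mathlib
import HarnessLib

/-!
# `ι(r)` is onto for every `r ≠ 0`: surjectivity of a ring-of-integers action on a divisible group from the surjectivity of the powers `x ↦ x^n`

Topic `Literature/Algebra/Module`; namespace `Literature.Algebra.Module.DivisibleActionSurjective`.  THEOREMS ONLY (no definition, no named fact, no `instance`, no
notation, no `sorry`), in the multiplicative `φ : 𝒪 → M → M` currency of ★ `DivisibleTorsionPointCount` ∕ ★ `DivisibleTorsionMultiplicativity` ∕ ★
`DivisibleTorsionIdealImage`.  Cell `hodgecm-mathlib` (D-0151), P6 «MOD» (crux hLiu418 = stmt-HodgeConjecture-24832, `--supports`, count-neutral): line L3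
(`stub_FROB`), ROOF road (ρ-𝔟) — the engine input **`hsurj : ∀ r ≠ 0, Function.Surjective (φ r)`** of ★ `natCard_torsion_mul` (M1), ★
`exists_mem_forall_torsion_exists_apply_eq` (DEC) and ★ `weilPairingLevel_eq_one_of_restrictPt_of_comp_i_eq_one` (F4b) (LA6-p03 (g0) 2026-09-02T04:38Z
«REMAINING ENGINE INPUTS … `hsurj` (isogenies onto on `κ̄`-points)»; LA3-p03 (g2) default organ).  No isogeny theory of `ι(r)` is needed: for `r ≠ 0` in the
ring of integers `𝒪 = 𝓞 F` of a number field the IDEAL NORM `n = N((r)) ∈ ℕ ∖ {0}` lies in `(r)` (Mathlib `Ideal.absNorm_mem`), i.e. `r ∣ n` in `𝒪`, so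
`φ(n) = φ(r) ∘ φ(n ∕ r)`; and `φ(n) = (· ^ n)` is onto on the points of an abelian variety over an algebraically closed field (★
`Motives.AbelianVariety.pow_surjective_of_isAlgClosed` ∕ `pow_surjective_of_isDominant`, any characteristic) — hence `φ(r)` is onto.  [MumfordAV1970] §6
App. 2 (p. 62) («`n_X` is surjective»), §19 Thm. 3 (p. 174) ff. (endomorphisms; `ι(r)` divides the integer `Nm(r)`); [MilneANT2008] Rem. 3.12 (p. 43)
(`N(𝔞) ∈ 𝔞`).  HC_CM is proved only modulo the printed citations until rung 0 closes; this file is generic and changes no count.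

* §1 (any commutative `𝒪`, any `M`) `surjective_of_comp_surjective` (if `φ(r·s)` is onto so is `φ(r)`), **`surjective_of_dvd_of_surjective`** (`r ∣ a`, `φ(a)` onto ⇒
  `φ(r)` onto), `surjective_of_dvd_natCast` (`r ∣ n`, `φ(n) = (·^n)` onto ⇒ `φ(r)` onto).
* §2 (`𝒪 = 𝓞 F`) `exists_nat_ne_zero_dvd` (`r ≠ 0 ⇒ ∃ n ≠ 0, r ∣ n`, namely `N((r))`), **`surjective_of_ne_zero`** — THE `hsurj` ROW: `φ(n) x = x^n` for all
  `n : ℕ` and `x ↦ x^n` onto for `n ≠ 0` ⇒ `φ(r)` onto for every `r ≠ 0`; `forall_surjective_of_ne_zero` (the binder shape `∀ r, r ≠ 0 → Surjective (φ r)`).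

## References
* [MumfordAV1970] D. Mumford, *Abelian Varieties* (1970), §6 Application 2 (p. 62), §19 Thm. 3 (p. 174).
* [MilneANT2008] J. S. Milne, *Algebraic Number Theory* (v3.00), Rem. 3.12 (p. 43) (`N(𝔞) ∈ 𝔞`).
-/

set_option autoImplicit false

namespace Literature.Algebra.Module.DivisibleActionSurjective

open NumberField

/-! ## §1 Surjectivity passes to divisors -/

section Generic

variable {M : Type*} {O : Type*} [CommSemiring O] (φ : O → M → M) (hcomp : ∀ r s x, φ (r * s) x = φ r (φ s x))
include hcomp

/-- If `φ(r·s)` is onto then `φ(r)` is onto (`φ(r·s) = φ(r) ∘ φ(s)`). [cite: MumfordAV1970, §19 Thm. 3 (p. 174)] -/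
theorem surjective_of_comp_surjective {r s : O} (h : Function.Surjective (φ (r * s))) : Function.Surjective (φ r) := by
  intro y
  obtain ⟨x, hx⟩ := h y
  exact ⟨φ s x, by rw [← hcomp, hx]⟩

/-- **`r ∣ a` and `φ(a)` onto ⇒ `φ(r)` onto.** [cite: MumfordAV1970, §19 Thm. 3 (p. 174)] -/
theorem surjective_of_dvd_of_surjective {r a : O} (hdvd : r ∣ a) (h : Function.Surjective (φ a)) : Function.Surjective (φ r) := by
  obtain ⟨s, rfl⟩ := hdvd
  exact surjective_of_comp_surjective φ hcomp h

omit hcomp in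
/-- `r ∣ n` with `φ(n) = (· ^ n)` onto ⇒ `φ(r)` onto. [cite: MumfordAV1970, §6 Application 2 (p. 62)] -/
theorem surjective_of_dvd_natCast [Monoid M] (hcomp : ∀ r s x, φ (r * s) x = φ r (φ s x)) (hnat : ∀ (n : ℕ) (x : M), φ (n : O) x = x ^ n)
    {r : O} {n : ℕ} (hdvd : r ∣ (n : O)) (hpow : Function.Surjective fun x : M => x ^ n) : Function.Surjective (φ r) := by
  refine surjective_of_dvd_of_surjective φ hcomp hdvd ?_
  intro y
  obtain ⟨x, hx⟩ := hpow y
  exact ⟨x, by rw [hnat]; exact hx⟩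

end Generic

/-! ## §2 The ring of integers of a number field: every `r ≠ 0` divides a nonzero natural number -/

section RingOfIntegers

variable {F : Type*} [Field F] [NumberField F]

/-- **`r ≠ 0` in `𝓞 F` divides the nonzero natural number `N((r))`** (the ideal norm lies in the ideal, Mathlib `Ideal.absNorm_mem`).
[cite: MilneANT2008, Rem. 3.12 (p. 43)] -/
theorem exists_nat_ne_zero_dvd (r : 𝓞 F) (hr : r ≠ 0) : ∃ n : ℕ, n ≠ 0 ∧ r ∣ (n : 𝓞 F) := by
  refine ⟨Ideal.absNorm (Ideal.span {r}), ?_, Ideal.mem_span_singleton.mp (Ideal.absNorm_mem _)⟩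
  rw [Ne, Ideal.absNorm_eq_zero_iff, Ideal.span_singleton_eq_bot]
  exact hr

variable {M : Type*} [Monoid M] (φ : 𝓞 F → M → M)

/-- **THE `hsurj` ROW: `φ(r)` is onto for every `r ≠ 0`**, for a multiplicative action `φ` of `𝓞 F` on a monoid `M` with `φ(n) = (· ^ n)` (`n : ℕ`) and all powers
`x ↦ x^n`, `n ≠ 0`, onto (the points of an abelian variety over an algebraically closed field, ★ `pow_surjective_of_isAlgClosed`∕`_of_isDominant`).
[cite: MumfordAV1970, §6 Application 2 (p. 62)] -/
theorem surjective_of_ne_zero (hcomp : ∀ r s x, φ (r * s) x = φ r (φ s x)) (hnat : ∀ (n : ℕ) (x : M), φ (n : 𝓞 F) x = x ^ n)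
    (hpow : ∀ n : ℕ, n ≠ 0 → Function.Surjective fun x : M => x ^ n) {r : 𝓞 F} (hr : r ≠ 0) : Function.Surjective (φ r) := by
  obtain ⟨n, hn, hdvd⟩ := exists_nat_ne_zero_dvd r hr
  exact surjective_of_dvd_natCast φ hcomp hnat hdvd (hpow n hn)

/-- The binder shape `∀ r, r ≠ 0 → Function.Surjective (φ r)` of ★ `natCard_torsion_mul` ∕ (DEC) ∕ (F4b). [cite: MumfordAV1970, §6 Application 2 (p. 62)] -/
theorem forall_surjective_of_ne_zero (hcomp : ∀ r s x, φ (r * s) x = φ r (φ s x)) (hnat : ∀ (n : ℕ) (x : M), φ (n : 𝓞 F) x = x ^ n)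
    (hpow : ∀ n : ℕ, n ≠ 0 → Function.Surjective fun x : M => x ^ n) : ∀ r : 𝓞 F, r ≠ 0 → Function.Surjective (φ r) :=
  fun _ hr => surjective_of_ne_zero φ hcomp hnat hpow hr

/-- Variant with the powers hypothesis only at the norms actually used: `∀ r ≠ 0, Surjective (· ^ N((r)))` suffices. [cite: MumfordAV1970, §6 Application 2 (p. 62)] -/
theorem surjective_of_ne_zero' (hcomp : ∀ r s x, φ (r * s) x = φ r (φ s x)) (hnat : ∀ (n : ℕ) (x : M), φ (n : 𝓞 F) x = x ^ n)
    {r : 𝓞 F} (hpow : Function.Surjective fun x : M => x ^ Ideal.absNorm (Ideal.span {r})) : Function.Surjective (φ r) :=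
  surjective_of_dvd_natCast φ hcomp hnat (Ideal.mem_span_singleton.mp (Ideal.absNorm_mem _)) hpow

end RingOfIntegers

end Literature.Algebra.Module.DivisibleActionSurjective
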